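import Literature.GroupTheory.CombinatorialGroupTheory.QuadraticWordsVertices
import Literature.GroupTheory.CombinatorialGroupTheory.QuadraticWordsSurfaceNormalForm
import HarnessLib

/-!
# One-vertex quadratic words present surface groups; the surface relator has one vertex

Topic `Literature/GroupTheory/CombinatorialGroupTheory`.  Zieschang–Vogt–Coldewey, *Surfaces and
Planar Discontinuous Groups*, LNM 835 (1980), §3.1–§3.2: a polygon with `4h` sides identified in
pairs, orientably, with ONE vertex class is a closed orientable surface of genus `h` (3.1.8:
`2 - 2g = V - m + 1`), and its boundary word is carried by bifurcations to the canonical form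
`∏_{i<h} [aᵢ, bᵢ]` (Thm. 3.2.6); in group-theoretic terms the one-relator group of a ONE-VERTEX
alternating quadratic word on `2h` symbols is the surface group `S_h`.  This file assembles the
statement from `OneVertex.nondeg` (`QuadraticWordsVertices.lean`: one vertex ⇒ nondegenerate
form) and `nonempty_presentedGroup_mulEquiv_surfaceGroup_of_nondeg`
(`QuadraticWordsSurfaceNormalForm.lean`: nondegenerate ⇒ surface normal form), and checks the
definition on the model: **the surface relator `∏ [aᵢ, bᵢ]` itself has one vertex**
(`oneVertex_surfaceWordStd`; its vertex map is the `4g`-cycle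
`0 → 4(g-1)+1 → 4(g-1)+2 → 4(g-1)+3 → 4(g-1) → 4(g-2)+1 → ⋯ → 1 → 2 → 3 → 0`).

This is the normal-form half of the Reidemeister–Schreier computation of the finite-index
subgroups of surface groups (ZVC Thm. 4.14.22 / Prop. 4.14.23: a subgroup of index `j` of `S_g` is
`S_{j(g-1)+1}`): the rewriting process delivers a one-vertex alternating quadratic word on
`2(j(g-1)+1)` symbols, and `OneVertex.nonempty_presentedGroup_mulEquiv_surfaceGroup_of_card`
turns it into the surface group.

## References

* H. Zieschang, E. Vogt, H.-D. Coldewey, *Surfaces and Planar Discontinuous Groups*, LNM 835,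
  Springer 1980, §3.1 (3.1.3–3.1.8), §3.2 (Thm. 3.2.6), §4.14 (4.14.22–23). [ZieschangVogtColdewey1980]
-/

namespace Literature.GroupTheory.CombinatorialGroupTheory

open List Literature.Topology.FourManifolds

/-! ### The surface relator has one vertex -/

section SurfaceWord

variable {g : ℕ}

/-- A list of `n` handle blocks has `4n` letters. [folklore] -/
private theorem length_flatMap_stdBlock (l : List (Fin g)) :
    (l.flatMap (fun i : Fin g => [((i, false), true), ((i, true), true), ((i, false), false), ((i, true), false)])).length = 4 * l.length := by
  induction l with
  | nil => rfl
  | cons i l ih => rw [flatMap_cons, length_append, ih]; simp; omega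

/-- The blocks of the handles in `l` avoid the symbols of a handle not in `l`. [folklore] -/
private theorem avoids_flatMap_stdBlock {l : List (Fin g)} {q : Fin g} (hq : q ∉ l) (b : Bool) :
    Avoids (q, b) (l.flatMap (fun i : Fin g => [((i, false), true), ((i, true), true), ((i, false), false), ((i, true), false)])) := by
  intro x hx
  simp only [mem_flatMap, mem_cons, not_mem_nil, or_false] at hx
  obtain ⟨i, hi, hx⟩ := hx
  have hiq : i ≠ q := fun h => hq (h ▸ hi)
  rcases hx with rfl | rfl | rfl | rfl <;> simp [hiq]

/-- **Splitting the standard surface word at a handle**: `∏ [aᵢ, bᵢ] = P · a_q b_q a_q⁻¹ b_q⁻¹ · S`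
with `|P| = 4q` and `P`, `S` avoiding the symbols `a_q`, `b_q`. [cite: ZieschangVogtColdewey1980, 3.1.8] -/
private theorem surfaceWordStd_split (q : Fin g) :
    ∃ P S : List ((Fin g × Bool) × Bool), surfaceWordStd g =
      P ++ [((q, false), true), ((q, true), true), ((q, false), false), ((q, true), false)] ++ S ∧ P.length = 4 * q.val ∧
      (∀ b, Avoids (q, b) P) ∧ (∀ b, Avoids (q, b) S) := by
  obtain ⟨l₁, l₂, hl⟩ := append_of_mem (mem_finRange q)
  have hnd := nodup_finRange g
  rw [hl] at hnd
  have hq₁ : q ∉ l₁ := fun h => by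
    have := (nodup_append.1 hnd).2.2 q h q mem_cons_self; exact this rfl
  have hq₂ : q ∉ l₂ := (nodup_cons.1 (nodup_append.1 hnd).2.1).1
  have hlen : l₁.length = q.val := by
    have h1 := idxOf_finRange q
    rw [hl, idxOf_append_of_notMem hq₁, idxOf_cons_self, Nat.add_zero] at h1
    exact h1
  refine ⟨l₁.flatMap (fun i : Fin g => [((i, false), true), ((i, true), true), ((i, false), false), ((i, true), false)]),
    l₂.flatMap (fun i : Fin g => [((i, false), true), ((i, true), true), ((i, false), false), ((i, true), false)]), ?_, ?_,
    fun b => avoids_flatMap_stdBlock hq₁ b, fun b => avoids_flatMap_stdBlock hq₂ b⟩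
  · rw [surfaceWordStd, hl, flatMap_append, flatMap_cons, append_assoc]
  · rw [length_flatMap_stdBlock, hlen]

/-- Positions `4q + r`, `r < 4`, are positions of the standard surface word. [folklore] -/
private theorem four_mul_lt {q : Fin g} {r : ℕ} (hr : r < 4) : 4 * q.val + r < (surfaceWordStd g).length := by
  rw [length_surfaceWordStd]; have := q.isLt; omega

/-- The partner positions in the standard surface word: `a_q ↔ a_q⁻¹`, `b_q ↔ b_q⁻¹`, i.e.
`4q ↔ 4q+2`, `4q+1 ↔ 4q+3`. [cite: ZieschangVogtColdewey1980, 3.1.8] -/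
private theorem partnerPos_surfaceWordStd (q : Fin g) :
    (partnerPos (surfaceWordStd g) ⟨4 * q.val, four_mul_lt (r := 0) (by omega)⟩).val = 4 * q.val + 2 ∧
    (partnerPos (surfaceWordStd g) ⟨4 * q.val + 1, four_mul_lt (r := 1) (by omega)⟩).val = 4 * q.val + 3 ∧
    (partnerPos (surfaceWordStd g) ⟨4 * q.val + 2, four_mul_lt (r := 2) (by omega)⟩).val = 4 * q.val ∧
    (partnerPos (surfaceWordStd g) ⟨4 * q.val + 3, four_mul_lt (r := 3) (by omega)⟩).val = 4 * q.val + 1 := by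
  obtain ⟨P, S, hw, hP, hPa, hSa⟩ := surfaceWordStd_split q
  -- split at `a_q`: `P ++ a⁺ :: ([b⁺] ++ a⁻ :: (b⁻ :: S))`
  have hwa : surfaceWordStd g = P ++ ((q, false), true) :: ([((q, true), true)] ++ ((q, false), !true) :: (((q, true), false) :: S)) := by
    rw [hw]; simp
  -- split at `b_q`: `(P ++ [a⁺]) ++ b⁺ :: ([a⁻] ++ b⁻ :: S)`
  have hwb : surfaceWordStd g = (P ++ [((q, false), true)]) ++ ((q, true), true) :: ([((q, false), false)] ++ ((q, true), !true) :: S) := by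
    rw [hw]; simp
  have hTa : Avoids (q, false) [((q, true), true)] := fun x hx => by simp at hx; subst hx; simp
  have hTb : Avoids (q, true) [((q, false), false)] := fun x hx => by simp at hx; subst hx; simp
  have hPb : Avoids (q, true) (P ++ [((q, false), true)]) :=
    avoids_append.2 ⟨hPa true, fun x hx => by simp at hx; subst hx; simp⟩
  have hl1 : (P ++ [((q, false), true)]).length = 4 * q.val + 1 := by simp [hP]
  refine ⟨?_, ?_, ?_, ?_⟩
  · have := partnerPos_eq_of_split_left hwa (hPa false) hTa (hP ▸ four_mul_lt (r := 0) (by omega))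
    simp only [hP, length_singleton] at this
    convert this using 2
  · have := partnerPos_eq_of_split_left hwb hPb hTb (hl1 ▸ four_mul_lt (r := 1) (by omega))
    simp only [hl1, length_singleton] at this
    convert this using 2
  · have := partnerPos_eq_of_split_right hwa (hPa false) (by simp only [hP, length_singleton]; exact four_mul_lt (r := 2) (by omega))
    simp only [hP, length_singleton] at this
    convert this using 2
  · have := partnerPos_eq_of_split_right hwb hPb (by simp only [hl1, length_singleton]; exact four_mul_lt (r := 3) (by omega))
    simp only [hl1, length_singleton] at this
    convert this using 2

/-- The vertex map of the standard surface word inside a block and across blocks: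
`ρ(4q+1) = 4q+2`, `ρ(4q+2) = 4q+3`, `ρ(4q+3) = 4q`, and `ρ(4q+4) = 4q+1` (the next block starts at
the vertex reached by `b_q⁻¹`). [cite: ZieschangVogtColdewey1980, 3.1.8] -/
private theorem vertexMap_surfaceWordStd (q : Fin g) :
    (vertexMap (surfaceWordStd g) ⟨4 * q.val + 1, four_mul_lt (r := 1) (by omega)⟩).val = 4 * q.val + 2 ∧
    (vertexMap (surfaceWordStd g) ⟨4 * q.val + 2, four_mul_lt (r := 2) (by omega)⟩).val = 4 * q.val + 3 ∧
    (vertexMap (surfaceWordStd g) ⟨4 * q.val + 3, four_mul_lt (r := 3) (by omega)⟩).val = 4 * q.val ∧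
    ∀ h4 : 4 * q.val + 4 < (surfaceWordStd g).length,
      (vertexMap (surfaceWordStd g) ⟨4 * q.val + 4, h4⟩).val = 4 * q.val + 1 := by
  obtain ⟨h0, h1, h2, h3⟩ := partnerPos_surfaceWordStd q
  have e : ∀ (r : ℕ) (hr : 4 * q.val + r + 1 < (surfaceWordStd g).length),
      predPos ⟨4 * q.val + r + 1, hr⟩ = ⟨4 * q.val + r, by omega⟩ := fun r hr =>
    Fin.ext (by rw [predPos_val_of_pos _ (by simp)]; simp)
  refine ⟨?_, ?_, ?_, fun h4 => ?_⟩
  · simp only [vertexMap]; rw [show (⟨4 * q.val + 1, _⟩ : Fin _) = ⟨4 * q.val + 0 + 1, four_mul_lt (r := 1) (by omega)⟩ from rfl, e 0]; simpa using h0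
  · simp only [vertexMap]; rw [e 1]; exact h1
  · simp only [vertexMap]; rw [e 2]; exact h2
  · simp only [vertexMap]; rw [e 3]; exact h3

/-- The vertex map of the standard surface word at position `0`: `ρ(0) = 4(g-1)+1`, the
partner of the last letter `b_{g-1}⁻¹`. [cite: ZieschangVogtColdewey1980, 3.1.8] -/
private theorem vertexMap_surfaceWordStd_zero (hg : 0 < g) (h0 : 0 < (surfaceWordStd g).length) :
    (vertexMap (surfaceWordStd g) ⟨0, h0⟩).val = 4 * (g - 1) + 1 := by
  obtain ⟨-, -, -, h3⟩ := partnerPos_surfaceWordStd (⟨g - 1, by omega⟩ : Fin g)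
  simp only [vertexMap]
  have e : predPos ⟨0, h0⟩ = ⟨4 * (g - 1) + 3, four_mul_lt (q := ⟨g - 1, by omega⟩) (r := 3) (by omega)⟩ :=
    Fin.ext (by
      rw [predPos_val_of_eq_zero _ rfl]
      have e := length_surfaceWordStd g
      show (surfaceWordStd g).length - 1 = 4 * (g - 1) + 3
      omega)
  rw [e]; exact h3

/-- Iterating the vertex map of the standard surface word from position `0` visits the blocks in
descending order: `ρ^{4s+1}(0) = 4(g-1-s)+1`. [cite: ZieschangVogtColdewey1980, 3.1.8] -/
private theorem iterate_vertexMap_surfaceWordStd_zero (hg : 0 < g) (h0 : 0 < (surfaceWordStd g).length)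
    (s : ℕ) (hs : s < g) :
    ((vertexMap (surfaceWordStd g))^[4 * s + 1] ⟨0, h0⟩).val = 4 * (g - 1 - s) + 1 := by
  induction s with
  | zero => simpa using vertexMap_surfaceWordStd_zero hg h0
  | succ s ih =>
    have ih' := ih (by omega)
    set q : Fin g := ⟨g - 1 - s, by omega⟩ with hq
    obtain ⟨e1, e2, e3, -⟩ := vertexMap_surfaceWordStd q
    have hq1 : 1 ≤ g - 1 - s := by omega
    set q' : Fin g := ⟨g - 1 - (s + 1), by omega⟩ with hq'
    obtain ⟨-, -, -, e4⟩ := vertexMap_surfaceWordStd q'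
    have hqq : 4 * q'.val + 4 = 4 * q.val := by simp [q, q']; omega
    -- four more steps: `4q+1 → 4q+2 → 4q+3 → 4q = 4q'+4 → 4q'+1`
    have step : ∀ (m : ℕ) (k : Fin (surfaceWordStd g).length) (v : ℕ) (hv : v < (surfaceWordStd g).length),
        ((vertexMap (surfaceWordStd g))^[m] ⟨0, h0⟩).val = k.val →
        (vertexMap (surfaceWordStd g) k).val = v →
        ((vertexMap (surfaceWordStd g))^[m + 1] ⟨0, h0⟩).val = v := by
      intro m k v hv hm hk
      rw [Function.iterate_succ_apply']
      have : (vertexMap (surfaceWordStd g))^[m] ⟨0, h0⟩ = k := Fin.ext hm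
      rw [this, hk]
    have s1 := step _ ⟨4 * q.val + 1, four_mul_lt (r := 1) (by omega)⟩ _ (four_mul_lt (q := q) (by omega : 2 < 4)) ih' e1
    have s2 := step _ ⟨4 * q.val + 2, four_mul_lt (r := 2) (by omega)⟩ _ (four_mul_lt (q := q) (by omega : 3 < 4)) s1 e2
    have s3 := step _ ⟨4 * q.val + 3, four_mul_lt (r := 3) (by omega)⟩ _ (four_mul_lt (q := q) (by omega : 0 < 4)) s2 e3
    have h4 : 4 * q'.val + 4 < (surfaceWordStd g).length := by rw [hqq]; exact four_mul_lt (r := 0) (by omega)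
    have s4 := step _ ⟨4 * q'.val + 4, h4⟩ _ (four_mul_lt (q := q') (r := 1) (by omega)) (by rw [s3]; simp [hqq])
      (e4 h4)
    rw [show 4 * (s + 1) + 1 = 4 * s + 1 + 1 + 1 + 1 + 1 by ring, s4]

/-- **The surface relator `∏ [aᵢ, bᵢ]` (`g ≥ 1`) has one vertex**: its vertex map is the single
cycle `0 → 4(g-1)+1 → 4(g-1)+2 → 4(g-1)+3 → 4(g-1) → 4(g-2)+1 → ⋯ → 1 → 2 → 3 → 0` (the
`4g`-gon with the standard identification has one vertex, ZVC 3.1.8: `2 - 2g = 1 - 2g + 1`).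
[cite: ZieschangVogtColdewey1980, 3.1.8] -/
theorem oneVertex_surfaceWordStd (hg : 0 < g) : OneVertex (surfaceWordStd g) := by
  have h0 : 0 < (surfaceWordStd g).length := by rw [length_surfaceWordStd]; omega
  set ρ := vertexMap (surfaceWordStd g) with hρ
  -- every position is reached from `0`
  have reach : ∀ k : Fin (surfaceWordStd g).length, ∃ m, ρ^[m] ⟨0, h0⟩ = k := by
    intro k
    have hk : k.val < 4 * g := by have h := k.isLt; have e := length_surfaceWordStd g; omega
    -- `k = 4q + r`, block `q = g - 1 - s`
    obtain ⟨q, r, hr, hkq⟩ : ∃ q r : ℕ, r < 4 ∧ k.val = 4 * q + r := ⟨k.val / 4, k.val % 4, Nat.mod_lt _ (by omega), (Nat.div_add_mod _ 4).symm⟩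
    have hqg : q < g := by omega
    set s := g - 1 - q with hs
    have hqs : q = g - 1 - s := by omega
    have base := iterate_vertexMap_surfaceWordStd_zero hg h0 s (by omega)
    rw [← hqs] at base
    obtain ⟨e1, e2, e3, e4⟩ := vertexMap_surfaceWordStd (⟨q, hqg⟩ : Fin g)
    simp only at e1 e2 e3 e4
    have step : ∀ (m : ℕ) (k' : Fin (surfaceWordStd g).length) (v : ℕ),
        (ρ^[m] ⟨0, h0⟩).val = k'.val → (ρ k').val = v → (ρ^[m + 1] ⟨0, h0⟩).val = v := by
      intro m k' v hm hk'
      rw [Function.iterate_succ_apply', show ρ^[m] ⟨0, h0⟩ = k' from Fin.ext hm, hk']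
    have s1 := step _ ⟨4 * q + 1, four_mul_lt (q := ⟨q, hqg⟩) (r := 1) (by omega)⟩ _ base e1
    have s2 := step _ ⟨4 * q + 2, four_mul_lt (q := ⟨q, hqg⟩) (r := 2) (by omega)⟩ _ s1 e2
    have s3 := step _ ⟨4 * q + 3, four_mul_lt (q := ⟨q, hqg⟩) (r := 3) (by omega)⟩ _ s2 e3
    rcases (by omega : r = 0 ∨ r = 1 ∨ r = 2 ∨ r = 3) with rfl | rfl | rfl | rfl
    · exact ⟨_, Fin.ext (by rw [s3, hkq]; rfl)⟩
    · exact ⟨_, Fin.ext (by rw [base, hkq])⟩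
    · exact ⟨_, Fin.ext (by rw [s1, hkq])⟩
    · exact ⟨_, Fin.ext (by rw [s2, hkq])⟩
  -- every position reaches `0`: `ρ^{4g} = id` along the cycle, so go forward `4g - m` steps
  have hcycle : ρ^[4 * g] ⟨0, h0⟩ = ⟨0, h0⟩ := by
    have h := iterate_vertexMap_surfaceWordStd_zero hg h0 (g - 1) (by omega)
    obtain ⟨e1, e2, e3, -⟩ := vertexMap_surfaceWordStd (⟨0, hg⟩ : Fin g)
    simp only [Nat.sub_self, mul_zero, zero_add] at h e1 e2 e3
    have step : ∀ (m : ℕ) (k' : Fin (surfaceWordStd g).length) (v : ℕ),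
        (ρ^[m] ⟨0, h0⟩).val = k'.val → (ρ k').val = v → (ρ^[m + 1] ⟨0, h0⟩).val = v := by
      intro m k' v hm hk'
      rw [Function.iterate_succ_apply', show ρ^[m] ⟨0, h0⟩ = k' from Fin.ext hm, hk']
    have s1 := step _ ⟨1, by rw [length_surfaceWordStd]; omega⟩ _ h e1
    have s2 := step _ ⟨2, by rw [length_surfaceWordStd]; omega⟩ _ s1 e2
    have s3 := step _ ⟨3, by rw [length_surfaceWordStd]; omega⟩ _ s2 e3
    exact Fin.ext (by rw [show 4 * g = 4 * (g - 1) + 1 + 1 + 1 + 1 by omega, s3])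
  intro k l
  obtain ⟨mk, hmk⟩ := reach k
  obtain ⟨ml, hml⟩ := reach l
  -- from `k` go back to `0` by completing the cycle, then forward to `l`
  have hback : ρ^[4 * g * (mk + 1) - mk] k = ⟨0, h0⟩ := by
    have hle : mk ≤ 4 * g * (mk + 1) := by nlinarith
    have hper : ∀ t, ρ^[4 * g * t] ⟨0, h0⟩ = ⟨0, h0⟩ := by
      intro t
      induction t with
      | zero => rfl
      | succ t ih => rw [Nat.mul_succ, Function.iterate_add_apply, hcycle, ih]
    rw [← hmk, ← Function.iterate_add_apply, Nat.sub_add_cancel hle, hper]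
  exact ⟨ml + (4 * g * (mk + 1) - mk), by rw [Function.iterate_add_apply, hback, hml]⟩

end SurfaceWord

/-! ### One-vertex words present surface groups -/

variable {ι : Type*} [DecidableEq ι] [Fintype ι]

/-- **A one-vertex alternating quadratic word is a relabelled surface relator**: if every symbol of
the finite alphabet `ι` occurs in the one-vertex alternating quadratic word `w`, then `|ι| = 2h` and
some isomorphism `F(a₁, b₁, …, a_h, b_h) ≅ F(ι)` carries `∏ [aᵢ, bᵢ]` to a conjugate of `w`
(ZVC Thm. 3.2.6 with 3.1.8). [cite: ZieschangVogtColdewey1980, Thm 3.2.6 / 3.1.8] -/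
theorem OneVertex.exists_mulEquiv_map_surfaceRelator {w : List (ι × Bool)} (hV : OneVertex w)
    (hq : IsQuadratic w) (hall : ∀ i, (i, true) ∈ w) :
    ∃ h : ℕ, Fintype.card ι = 2 * h ∧
      ∃ (Λ : FreeGroup (surfaceGen h) ≃* FreeGroup ι) (c : FreeGroup ι),
        Λ (surfaceRelator h) = c * FreeGroup.mk w * c⁻¹ :=
  exists_mulEquiv_map_surfaceRelator_of_nondeg hq hall (hV.nondeg hq hall)

/-- **The one-relator group of a one-vertex alternating quadratic word is a surface group**
`⟨ι ∣ w⟩ ≅ S_h`, `|ι| = 2h` (ZVC Thm. 3.2.6 / 3.1.8). [cite: ZieschangVogtColdewey1980, Thm 3.2.6 / 3.1.8] -/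
theorem OneVertex.nonempty_presentedGroup_mulEquiv_surfaceGroup {w : List (ι × Bool)} (hV : OneVertex w)
    (hq : IsQuadratic w) (hall : ∀ i, (i, true) ∈ w) :
    ∃ h : ℕ, Fintype.card ι = 2 * h ∧
      Nonempty (PresentedGroup ({FreeGroup.mk w} : Set (FreeGroup ι)) ≃* SurfaceGroup h) :=
  nonempty_presentedGroup_mulEquiv_surfaceGroup_of_nondeg hq hall (hV.nondeg hq hall)

/-- The same with the genus read off from the alphabet: `|ι| = 2h ⇒ ⟨ι ∣ w⟩ ≅ S_h` — the form
consumed by the Reidemeister–Schreier computation of finite-index subgroups of surface groups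
(ZVC 4.14.22). [cite: ZieschangVogtColdewey1980, Thm 3.2.6 / 4.14.22] -/
theorem OneVertex.nonempty_presentedGroup_mulEquiv_surfaceGroup_of_card {w : List (ι × Bool)}
    (hV : OneVertex w) (hq : IsQuadratic w) (hall : ∀ i, (i, true) ∈ w) {h : ℕ}
    (hcard : Fintype.card ι = 2 * h) :
    Nonempty (PresentedGroup ({FreeGroup.mk w} : Set (FreeGroup ι)) ≃* SurfaceGroup h) :=
  nonempty_presentedGroup_mulEquiv_surfaceGroup_of_nondeg_of_card hq hall (hV.nondeg hq hall) hcard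

end Literature.GroupTheory.CombinatorialGroupTheory
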